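import Literature.Computability.AlgebraicComplexity.DiPatternExpressions
import Mathlib
import HarnessLib

/-!
# Route MonotoneRestoration — aside `OrbitCompressionQP` (stmt-ValiantsHypothesis-18332): the PEELING LEMMA
# — injective sums of one-sorted expression values are expression values

Step (iii) of the extraction S1b′ (item evidence `S1b-plan.md`): after the Reynolds step
(`OrbitSupport.sum_stabiliser_comp_eq_smul_sum_injective`) a supported value is a sum, over INJECTIVE
assignments of some labels avoiding the values of the fixed labels, of values of a one-sorted expression.
Such an injective sum is again the value of a one-sorted expression with the SAME label set: peel one
summed label `a` at a time — the sum over the admissible values of `a` is the free sum (`sumLabel a`) minus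
the collisions, and a collision `ℓ a = ℓ b` is the capture-avoiding identification `subst a b`
(`DiPatternExpr.value_subst`).

* `value_foldr_add` — the value of a syntactic sum of a list of expressions;
* `sum_sdiff_image_eq_value` — one peeling step:
  `Σ_{v ∉ ℓ(T)} value e (ℓ[a := v]) = value (sumLabel a e - Σ_{b ∈ T} subst a b e) ℓ` for `ℓ` injective on
  `T`, `a ∉ T`;
* `exists_injSum_expr` — **for every expression `e`, fixed labels `Fx` and list `L` of further distinct
  labels there is an expression `e'` with `value e' ℓ = Σ value e ℓ'` over all `ℓ'` that agree with `ℓ`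
  off `L` and are injective on `L ∪ Fx`, for every `ℓ` injective on `Fx`.**

Helper file (`--supports stmt-ValiantsHypothesis-18332`); def-free; nothing here is a named fact.
-/

noncomputable section

open scoped Classical

-- `Summit.ValiantsHypothesis.ValiantsHypothesis.…` is the tree's single-conjunct layout (Sub = Summit).
set_option linter.dupNamespace false

namespace Summit.ValiantsHypothesis.ValiantsHypothesis.Theorems

namespace OrbitSupport

open Literature.Computability.AlgebraicComplexity MvPolynomial DiPatternExpr

variable {k : ℕ}

/-- The value of a syntactic sum of a list of expressions. [folklore] -/
theorem value_foldr_add (n : ℕ) (Es : List (DiPatternExpr ℂ k)) (ℓ : Fin k → Fin n) :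
    value n (Es.foldr add (const 0)) ℓ = (Es.map fun E => value n E ℓ).sum := by
  induction Es with
  | nil => simp
  | cons E Es ih => simp [ih]

/-- **One peeling step.**  For `ℓ` injective on a finite set `T` of labels and `a ∉ T`:
the sum of `value e (ℓ[a := v])` over the values `v` NOT taken by `ℓ` on `T` is the value at `ℓ` of
`sumLabel a e` minus the identifications `subst a b e`, `b ∈ T`. [cite: DawarPagoSeppelt2025, §4] -/
theorem sum_sdiff_image_eq_value (n : ℕ) (e : DiPatternExpr ℂ k) (a : Fin k) (T : List (Fin k))
    (hT : T.Nodup) (ℓ : Fin k → Fin n)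
    (hinj : ∀ x ∈ T, ∀ y ∈ T, ℓ x = ℓ y → x = y) :
    ∑ v ∈ Finset.univ \ T.toFinset.image ℓ, value n e (Function.update ℓ a v) =
      value n (add (sumLabel a e) (mul (const (-1)) ((T.map fun b => DiPatternExpr.subst a b e).foldr add (const 0)))) ℓ := by
  rw [value_add, value_sumLabel, value_mul, value_const, value_foldr_add, List.map_map]
  have himg : ∑ v ∈ T.toFinset.image ℓ, value n e (Function.update ℓ a v) =
      ∑ b ∈ T.toFinset, value n e (Function.update ℓ a (ℓ b)) :=
    Finset.sum_image fun x hx y hy h => hinj x (List.mem_toFinset.1 hx) y (List.mem_toFinset.1 hy) h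
  have hsplit := Finset.sum_sdiff (f := fun v => value n e (Function.update ℓ a v))
    (Finset.subset_univ (T.toFinset.image ℓ))
  rw [← hsplit, himg, List.sum_toFinset _ hT]
  simp only [Function.comp_def, value_subst, map_neg, map_one, neg_mul, one_mul]
  ring

/-- **THE PEELING LEMMA.**  For every one-sorted expression `e`, finite set `Fx` of fixed labels and list
`L` of distinct further labels, there is an expression `e'` (same label set) whose value at every `ℓ`
injective on `Fx` is the sum of `value e ℓ'` over all assignments `ℓ'` that agree with `ℓ` off `L` and
are injective on `L ∪ Fx` (an INJECTIVE sum over the labels of `L`, avoiding the values of `Fx`).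
[cite: DawarPagoSeppelt2025, §4] -/
theorem exists_injSum_expr (Fx : Finset (Fin k)) :
    ∀ (L : List (Fin k)), L.Nodup → (∀ a ∈ L, a ∉ Fx) → ∀ e : DiPatternExpr ℂ k,
      ∃ e' : DiPatternExpr ℂ k, ∀ (n : ℕ) (ℓ : Fin k → Fin n),
        (∀ x ∈ Fx, ∀ y ∈ Fx, ℓ x = ℓ y → x = y) →
        value n e' ℓ = ∑ ℓ' ∈ Finset.univ.filter (fun ℓ' : Fin k → Fin n =>
            (∀ x, x ∉ L → ℓ' x = ℓ x) ∧
            ∀ x ∈ L.toFinset ∪ Fx, ∀ y ∈ L.toFinset ∪ Fx, ℓ' x = ℓ' y → x = y),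
          value n e ℓ' := by
  intro L
  induction L with
  | nil =>
    intro _ _ e
    refine ⟨e, fun n ℓ hℓ => ?_⟩
    rw [show (Finset.univ.filter fun ℓ' : Fin k → Fin n => (∀ x, x ∉ ([] : List (Fin k)) → ℓ' x = ℓ x) ∧
        ∀ x ∈ ([] : List (Fin k)).toFinset ∪ Fx, ∀ y ∈ ([] : List (Fin k)).toFinset ∪ Fx,
          ℓ' x = ℓ' y → x = y) = {ℓ} from ?_]
    · rw [Finset.sum_singleton]
    · ext ℓ'
      simp only [List.not_mem_nil, not_false_eq_true, forall_const, List.toFinset_nil,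
        Finset.empty_union, Finset.mem_filter, Finset.mem_univ, true_and, Finset.mem_singleton]
      constructor
      · rintro ⟨h, -⟩; exact funext h
      · rintro rfl; exact ⟨fun _ => rfl, hℓ⟩
  | cons a rest ih =>
    intro hnd hFx e
    have ha : a ∉ rest := (List.nodup_cons.1 hnd).1
    have haFx : a ∉ Fx := hFx a (by simp)
    have hrest : rest.Nodup := (List.nodup_cons.1 hnd).2
    -- the peeled expression
    set T : List (Fin k) := rest ++ Fx.toList with hTdef
    have hTnd : T.Nodup := by
      rw [hTdef, List.nodup_append]
      refine ⟨hrest, Fx.nodup_toList, fun x hx y hy => ?_⟩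
      rintro rfl
      exact hFx x (by simp [hx]) (Finset.mem_toList.1 hy)
    set E : DiPatternExpr ℂ k :=
      add (sumLabel a e) (mul (const (-1)) ((T.map fun b => DiPatternExpr.subst a b e).foldr add (const 0))) with hE
    obtain ⟨e', he'⟩ := ih hrest (fun b hb => hFx b (by simp [hb])) E
    refine ⟨e', fun n ℓ hℓ => ?_⟩
    rw [he' n ℓ hℓ]
    -- abbreviations for the two index sets
    set Srest := Finset.univ.filter (fun ℓ' : Fin k → Fin n =>
        (∀ x, x ∉ rest → ℓ' x = ℓ x) ∧
        ∀ x ∈ rest.toFinset ∪ Fx, ∀ y ∈ rest.toFinset ∪ Fx, ℓ' x = ℓ' y → x = y) with hSrest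
    set Sall := Finset.univ.filter (fun ℓ' : Fin k → Fin n =>
        (∀ x, x ∉ a :: rest → ℓ' x = ℓ x) ∧
        ∀ x ∈ (a :: rest).toFinset ∪ Fx, ∀ y ∈ (a :: rest).toFinset ∪ Fx, ℓ' x = ℓ' y → x = y) with hSall
    have hTset : ∀ x, x ∈ T.toFinset ↔ x ∈ rest.toFinset ∪ Fx := fun x => by
      simp [hTdef, List.mem_toFinset, Finset.mem_union]
    -- Step 1: on `Srest`, the value of `E` is the peeled sum
    have hstep : ∀ ℓ'' ∈ Srest, value n E ℓ'' =
        ∑ v ∈ Finset.univ \ T.toFinset.image ℓ'', value n e (Function.update ℓ'' a v) := by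
      intro ℓ'' hℓ''
      rw [hSrest, Finset.mem_filter] at hℓ''
      rw [hE, ← sum_sdiff_image_eq_value n e a T hTnd ℓ'' fun x hx y hy h =>
        hℓ''.2.2 x ((hTset x).1 (List.mem_toFinset.2 hx)) y ((hTset y).1 (List.mem_toFinset.2 hy)) h]
    rw [Finset.sum_congr rfl hstep]
    -- Step 2: re-index `(ℓ'', v) ↦ ℓ''[a := v]`
    rw [show (∑ ℓ'' ∈ Srest, ∑ v ∈ Finset.univ \ T.toFinset.image ℓ'', value n e (Function.update ℓ'' a v)) =
        ∑ p ∈ Srest.sigma (fun ℓ'' => Finset.univ \ T.toFinset.image ℓ''),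
          value n e (Function.update p.1 a p.2) from
      (Finset.sum_sigma Srest (fun ℓ'' => Finset.univ \ T.toFinset.image ℓ'')
        (fun p : (Σ _ : Fin k → Fin n, Fin n) => value n e (Function.update p.1 a p.2))).symm]
    have key : ∀ z ∈ (a :: rest).toFinset ∪ Fx, z ≠ a → z ∈ rest.toFinset ∪ Fx := by
      intro z hz hza
      simp only [List.toFinset_cons, Finset.mem_union, Finset.mem_insert] at hz ⊢
      tauto
    have sub : ∀ z ∈ rest.toFinset ∪ Fx, z ∈ (a :: rest).toFinset ∪ Fx := by
      intro z hz
      simp only [List.toFinset_cons, Finset.mem_union, Finset.mem_insert] at hz ⊢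
      tauto
    have hne : ∀ z ∈ rest.toFinset ∪ Fx, z ≠ a := by
      rintro z hz rfl
      rcases Finset.mem_union.1 hz with hz | hz
      · exact ha (List.mem_toFinset.1 hz)
      · exact haFx hz
    refine Finset.sum_bij' (fun p _ => Function.update p.1 a p.2)
      (fun ℓ' _ => (⟨Function.update ℓ' a (ℓ a), ℓ' a⟩ : Σ _ : Fin k → Fin n, Fin n)) ?_ ?_ ?_ ?_ ?_
    · -- the re-indexed assignment lies in `Sall`
      intro p hp
      rw [Finset.mem_sigma] at hp
      obtain ⟨hp1, hp2⟩ := hp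
      rw [hSrest, Finset.mem_filter] at hp1
      obtain ⟨-, hoff, hinj⟩ := hp1
      rw [Finset.mem_sdiff, Finset.mem_image] at hp2
      rw [hSall, Finset.mem_filter]
      refine ⟨Finset.mem_univ _, fun x hx => ?_, fun x hx y hy h => ?_⟩
      · have hxa : x ≠ a := fun h => hx (by simp [h])
        rw [Function.update_of_ne hxa]
        exact hoff x fun h' => hx (by simp [h'])
      · by_cases hxa : x = a
        · by_cases hya : y = a
          · rw [hxa, hya]
          · exfalso
            subst hxa
            rw [Function.update_self, Function.update_of_ne hya] at h
            exact hp2.2 ⟨y, (hTset y).2 (key y hy hya), h.symm⟩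
        · by_cases hya : y = a
          · exfalso
            subst hya
            rw [Function.update_self, Function.update_of_ne hxa] at h
            exact hp2.2 ⟨x, (hTset x).2 (key x hx hxa), h⟩
          · rw [Function.update_of_ne hxa, Function.update_of_ne hya] at h
            exact hinj x (key x hx hxa) y (key y hy hya) h
    · -- the inverse lands in the sigma set
      intro ℓ' hℓ'
      rw [hSall, Finset.mem_filter] at hℓ'
      obtain ⟨-, hoff, hinj⟩ := hℓ'
      rw [Finset.mem_sigma]
      dsimp only
      refine ⟨?_, ?_⟩
      · rw [hSrest, Finset.mem_filter]
        refine ⟨Finset.mem_univ _, fun x hx => ?_, fun x hx y hy h => ?_⟩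
        · by_cases hxa : x = a
          · subst hxa; simp
          · rw [Function.update_of_ne hxa]; exact hoff x (by simp [hxa, hx])
        · rw [Function.update_of_ne (hne x hx), Function.update_of_ne (hne y hy)] at h
          exact hinj x (sub x hx) y (sub y hy) h
      · rw [Finset.mem_sdiff, Finset.mem_image]
        refine ⟨Finset.mem_univ _, ?_⟩
        rintro ⟨x, hx, hxv⟩
        have hx' := (hTset x).1 hx
        rw [Function.update_of_ne (hne x hx')] at hxv
        exact hne x hx' (hinj x (sub x hx') a (by simp) hxv)
    · -- left inverse on the sigma set
      rintro ⟨ℓ'', v⟩ hp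
      rw [Finset.mem_sigma] at hp
      obtain ⟨hp1, -⟩ := hp
      rw [hSrest, Finset.mem_filter] at hp1
      obtain ⟨-, hoff, -⟩ := hp1
      dsimp only
      simp only [Sigma.mk.injEq, heq_iff_eq, Function.update_self, Function.update_idem,
        Function.update_eq_self_iff, and_true]
      exact (hoff a ha).symm
    · -- right inverse on `Sall`
      intro ℓ' _
      simp
    · -- values agree
      intro p _
      rfl

end OrbitSupport

end Summit.ValiantsHypothesis.ValiantsHypothesis.Theorems

end
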